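import Summits.BirchSwinnertonDyer.BirchSwinnertonDyer.Theorems.ByReductionTypeAtTwoKatoFreeSandwichMeasureDepth
import Literature.NumberTheory.EllipticCurves.ManinConstantGamma1ModularDegree
import Literature.NumberTheory.EllipticCurves.ManinConstantGamma1Gamma0Comparison
import Literature.NumberTheory.EllipticCurves.ManinConstantGamma1Gamma0LedgerProofs
import Literature.NumberTheory.EllipticCurves.ModularCurveRealPeriodProofs
import Literature.NumberTheory.EllipticCurves.RealLatticeCovolumeProofs
import Literature.NumberTheory.EllipticCurves.LatticeInclusionIsogenyDegreeProofs
import Literature.NumberTheory.EllipticCurves.IsogenyDualProofs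
import Summits.BirchSwinnertonDyer.Rank1Residual.ManinAdditive.KatoCurvePlusDefectProofs
import HarnessLib

/-!
# Route `ByReductionTypeAtTwo` (K4), crux `OrdMissingLowerBoundAtTwo` (stmt-BirchSwinnertonDyer-19577), line
# `kato-free-lower-sandwich-two` — (β) PERIOD DESCENT OF AN EISENSTEIN FUNCTIONAL via the `X₁(N)`-optimal curve
# (`--supports`, helper; the registered research stub `stub_periodDescentOfEisenstein` becomes a theorem MODULO the
# Literature named fact `exists_optimal_gamma1ParametrizationData` (Stevens 1989 §2 / Conrad–Edixhoven–Stein 2003 §6.1))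

Cell `bsd-2adic`, lead `cruxlead-stmt-BirchSwinnertonDyer-19577` (g2).  THEOREMS ONLY — no definition, no named fact, no
`sorry`; closes nothing; BSD is not proved by any of this.  The lattice route is the one kernel-checked by crux-triage r1-1
(GEN 10) in `Cruxes/OrdMissingLowerBoundAtTwo/TRIAGE_r1_1_BetaViaE1.lean` — adapted here into `Theorems/` (Cruxes files are not
importable): if the integer period functional `m` of the newform `f` (`re{∞,γ∞}_f = m(γ)·Ω⁺_f/2`) is EISENSTEIN mod `2^{s+1}`
(`m ≡ χ∘(d mod N)`), then `2^{s+1} ∣ m` on `Γ₁(N)` (`d ≡ 1`, `m(1) = 0`), so `re Λ₁(f) ⊆ 2ˢ Ω⁺_f ℤ` for the `Γ₁(N)`-period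
lattice `Λ₁(f)`; the `X₁(N)`-OPTIMAL curve `W₁` of the class (`Λ_{W₁} = c₁Λ₁(f)`, `c₁ ∈ ℤ`) has `Ω(W₁)/2 ∈ re Λ_{W₁}`, hence
`Ω(W₁) ∈ c₁ 2^{s+1} Ω⁺_f ℤ`, while `Ω(E₀) = |c₀| Ω⁺_f` with `c₀` odd (Abbes–Ullmo at `2 ∤ N`): `Ω(W₁) = r Ω(E₀)`,
`v₂(r) ≥ s + 1`.  `periodDescentOfEisenstein_of_gamma1Optimal` is the registered stub's statement VERBATIM behind the single
hypothesis `exists_optimal_gamma1ParametrizationData`.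
-/

set_option linter.dupNamespace false
set_option autoImplicit false

noncomputable section

open scoped MatrixGroups ModularForm
open CongruenceSubgroup Complex WeierstrassCurve Literature.NumberTheory.EllipticCurves
  Literature.NumberTheory.EllipticCurves.ModularForms

namespace Summit.BirchSwinnertonDyer.BirchSwinnertonDyer.Theorems.PeriodDescentGamma1

-- adapted from Cruxes/OrdMissingLowerBoundAtTwo/TRIAGE_r1_1_BetaViaE1.lean (crux-triage r1-1 GEN 10)

variable {N : ℕ} (f : CuspForm (Gamma0 N) 2)

/-- `d ≡ 1 (mod N)` on `Γ₁(N)`. [folklore] -/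
theorem gamma0Map_of_gamma1 (γ : Gamma1 N) :
    Gamma0Map N ⟨(γ : SL(2, ℤ)), Gamma1_in_Gamma0 N γ.2⟩ = 1 := by
  have h := (Gamma1_mem N (γ : SL(2, ℤ))).mp γ.2
  simp only [Gamma0Map, MonoidHom.coe_mk, OneHom.coe_mk]
  exact h.2.1

/-- If the integer period functional `m` (`re {∞,γ∞}_f = m(γ) Ω⁺_f/2`) is Eisenstein mod `2^{s+1}` then `2^{s+1} ∣ m(γ)`
for every `γ ∈ Γ₁(N)` (`m(γ) ≡ χ(d(γ)) = χ(d(1)) ≡ m(1) = 0`). [folklore] -/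
theorem two_pow_dvd_of_gamma1 (hΩ : plusPeriod f ≠ 0) (s : ℕ) (m : Gamma0 N → ℤ)
    (hm : ∀ γ, (cuspSymbol f γ).re = m γ * (plusPeriod f / 2))
    (χ : ZMod N → ZMod (2 ^ (s + 1)))
    (hχ : ∀ γ, ((m γ : ℤ) : ZMod (2 ^ (s + 1))) = χ (Gamma0Map N γ))
    (γ : Gamma1 N) :
    (2 : ℤ) ^ (s + 1) ∣ m ⟨(γ : SL(2, ℤ)), Gamma1_in_Gamma0 N γ.2⟩ := by
  have h1 : m 1 = 0 := by
    have h := hm 1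
    rw [cuspSymbol_one, Complex.zero_re] at h
    have hne : (plusPeriod f / 2 : ℝ) ≠ 0 := div_ne_zero hΩ two_ne_zero
    have : (m 1 : ℝ) = 0 := by
      by_contra hm1
      exact (mul_ne_zero hm1 hne) h.symm
    exact_mod_cast this
  have hγ := hχ ⟨(γ : SL(2, ℤ)), Gamma1_in_Gamma0 N γ.2⟩
  rw [gamma0Map_of_gamma1, ← map_one (Gamma0Map N), ← hχ 1, h1, Int.cast_zero] at hγ
  have hγ' : (((2 ^ (s + 1) : ℕ) : ℤ) ∣ m ⟨(γ : SL(2, ℤ)), Gamma1_in_Gamma0 N γ.2⟩) :=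
    (ZMod.intCast_zmod_eq_zero_iff_dvd _ _).mp hγ
  simpa using hγ'

/-- Under the same hypotheses every `z ∈ Λ₁(f)` has `re z ∈ 2^{s+1}(Ω⁺_f/2)ℤ = 2ˢ Ω⁺_f ℤ`. [folklore] -/
theorem re_periodLatticeGamma1_of_eisenstein (hΩ : plusPeriod f ≠ 0) (s : ℕ) (m : Gamma0 N → ℤ)
    (hm : ∀ γ, (cuspSymbol f γ).re = m γ * (plusPeriod f / 2))
    (χ : ZMod N → ZMod (2 ^ (s + 1)))
    (hχ : ∀ γ, ((m γ : ℤ) : ZMod (2 ^ (s + 1))) = χ (Gamma0Map N γ))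
    {z : ℂ} (hz : z ∈ periodLatticeGamma1 f) :
    ∃ n : ℤ, z.re = n * (2 ^ (s + 1) * (plusPeriod f / 2)) := by
  have hz' : z ∈ AddSubgroup.closure
      (Set.range fun γ : Gamma1 N ↦ cuspSymbol f ⟨(γ : SL(2, ℤ)), Gamma1_in_Gamma0 N γ.2⟩) := hz
  induction hz' using AddSubgroup.closure_induction with
  | mem x hx =>
    obtain ⟨γ, rfl⟩ := hx
    obtain ⟨k, hk⟩ := two_pow_dvd_of_gamma1 f hΩ s m hm χ hχ γ
    refine ⟨k, ?_⟩
    rw [hm, hk]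
    push_cast
    ring
  | zero => exact ⟨0, by simp⟩
  | add x y hx0 hy0 hx hy =>
    obtain ⟨a, ha⟩ := hx hx0
    obtain ⟨b, hb⟩ := hy hy0
    exact ⟨a + b, by rw [Complex.add_re, ha, hb]; push_cast; ring⟩
  | neg x hx0 hx =>
    obtain ⟨a, ha⟩ := hx hx0
    exact ⟨-a, by rw [Complex.neg_re, ha]; push_cast; ring⟩

/-- If a lattice `Λ ⊆ ℂ` lies in `c₁ Λ₁(f)` and `Ω₁/2 ∈ re Λ`, then `Ω₁ ∈ c₁ 2^{s+1} Ω⁺_f ℤ`. [folklore] -/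
theorem realPeriod_eq_of_sublattice (hΩ : plusPeriod f ≠ 0) (s : ℕ) (m : Gamma0 N → ℤ)
    (hm : ∀ γ, (cuspSymbol f γ).re = m γ * (plusPeriod f / 2))
    (χ : ZMod N → ZMod (2 ^ (s + 1)))
    (hχ : ∀ γ, ((m γ : ℤ) : ZMod (2 ^ (s + 1))) = χ (Gamma0Map N γ))
    (Λ : Set ℂ) (c₁ : ℤ) (hΛ : ∀ z ∈ Λ, ∃ w ∈ periodLatticeGamma1 f, z = c₁ * w)
    (Ω₁ : ℝ) (hhalf : ∃ z ∈ Λ, z.re = Ω₁ / 2) :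
    ∃ j : ℤ, Ω₁ = j * (c₁ * 2 ^ (s + 1) * plusPeriod f) := by
  obtain ⟨z, hz, hzre⟩ := hhalf
  obtain ⟨w, hw, rfl⟩ := hΛ z hz
  obtain ⟨n, hn⟩ := re_periodLatticeGamma1_of_eisenstein f hΩ s m hm χ hχ hw
  refine ⟨n, ?_⟩
  have h2 : Ω₁ = 2 * (((c₁ : ℂ) * w).re) := by rw [hzre]; ring
  rw [h2, Complex.mul_re, Complex.intCast_re, Complex.intCast_im, hn]
  ring

/-- Valuation arithmetic: from `Ω₁ = j c₁ 2^{s+1} Ω⁺_f`, `Ω₀ = |c₀| Ω⁺_f` with `c₀` odd and `Ω₁ ≠ 0`: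
`Ω₁ = r Ω₀` with `v₂(r) ≥ s+1`. [folklore] -/
theorem padicValRat_ratio_ge (s : ℕ) (Ωf Ω₀ Ω₁ : ℝ) (j c₁ c₀ : ℤ)
    (h1 : Ω₁ = j * (c₁ * 2 ^ (s + 1) * Ωf)) (h0 : Ω₀ = |(c₀ : ℝ)| * Ωf)
    (hc₀ : ¬ (2 : ℤ) ∣ c₀) (hΩ₁ : Ω₁ ≠ 0) :
    ∃ r : ℚ, Ω₁ = (r : ℝ) * Ω₀ ∧ ((s : ℤ) + 1) ≤ padicValRat 2 r := by
  have hc₀0 : c₀ ≠ 0 := by rintro rfl; exact hc₀ (dvd_zero 2)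
  have habs : (|c₀| : ℤ) ≠ 0 := abs_ne_zero.mpr hc₀0
  have habsR : (|(c₀ : ℝ)|) ≠ 0 := by exact_mod_cast (abs_ne_zero.mpr (Int.cast_ne_zero.mpr hc₀0) : |(c₀:ℝ)| ≠ 0)
  have hjc : j * c₁ ≠ 0 := by
    intro h
    apply hΩ₁
    have h' : (j : ℝ) * c₁ = 0 := by exact_mod_cast h
    rw [h1]
    calc (j : ℝ) * (c₁ * 2 ^ (s + 1) * Ωf) = ((j : ℝ) * c₁) * (2 ^ (s + 1) * Ωf) := by ring
      _ = 0 := by rw [h', zero_mul]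
  have hΩf : Ωf = Ω₀ / |(c₀ : ℝ)| := by rw [h0]; field_simp
  refine ⟨((j * c₁ : ℤ) : ℚ) * (2 : ℚ) ^ (s + 1) / ((|c₀| : ℤ) : ℚ), ?_, ?_⟩
  · rw [h1, hΩf]
    push_cast
    rw [← Int.cast_abs]
    field_simp
  · have hq1 : ((j * c₁ : ℤ) : ℚ) ≠ 0 := by exact_mod_cast hjc
    have hq2 : ((2 : ℚ) ^ (s + 1)) ≠ 0 := pow_ne_zero _ two_ne_zero
    have hq3 : (((|c₀| : ℤ)) : ℚ) ≠ 0 := by exact_mod_cast habs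
    have h22 : padicValRat 2 2 = 1 := by simpa using padicValRat.self (p := 2) one_lt_two
    have h0' : padicValInt 2 |c₀| = 0 :=
      padicValInt.eq_zero_of_not_dvd (p := 2) (by rwa [Nat.cast_ofNat, dvd_abs])
    rw [padicValRat.div (mul_ne_zero hq1 hq2) hq3, padicValRat.mul hq1 hq2, padicValRat.pow (2 : ℚ),
      padicValRat.of_int, padicValRat.of_int, h22, h0']
    push_cast
    have : (0 : ℤ) ≤ (padicValInt 2 (j * c₁) : ℤ) := by positivity
    linarith

-- `Ω(W)/2 ∈ re Λ` for a bare Néron lattice: `KatoCurve.neronLatticeRePartAttained_holds` (tree).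


/-- **(β) for an `X₁(N)`-optimal curve of the class.**  `E₀` with a lattice-optimal `X₀(N)`-datum `D₀` (`c₀` odd given),
`W₁` with an OPTIMAL `Γ₁(N)`-datum `D₁` of the same newform: an integer period functional of `f` Eisenstein mod `2^{s+1}`
forces `Ω(W₁) = r Ω(E₀)`, `v₂(r) ≥ s + 1`. [cite: Stevens1989, §2] -/
theorem periodDescent_of_gamma1Optimal
    {E₀ : WeierstrassCurve ℚ} [E₀.IsElliptic] {M : ℕ} [NeZero M]
    (D₀ : ModularParametrizationData E₀ M) (hopt₀ : ∀ z ∈ D₀.L.lattice, ∃ w ∈ periodLattice D₀.f, z = D₀.c * w)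
    (hc₀ : ¬ (2 : ℤ) ∣ D₀.maninConstant)
    {W₁ : WeierstrassCurve ℚ} [W₁.IsElliptic] (D₁ : Gamma1ParametrizationData W₁ M)
    (hf : D₁.f = D₀.f) (hopt : D₁.IsOptimal)
    (s : ℕ) (m : Gamma0 M → ℤ)
    (hm : ∀ γ, (cuspSymbol D₀.f γ).re = m γ * (plusPeriod D₀.f / 2))
    (χ : ZMod M → ZMod (2 ^ (s + 1)))
    (hχ : ∀ γ, ((m γ : ℤ) : ZMod (2 ^ (s + 1))) = χ (Gamma0Map M γ)) :
    ∃ r : ℚ, W₁.realPeriodRat = (r : ℝ) * E₀.realPeriodRat ∧ ((s : ℤ) + 1) ≤ padicValRat 2 r := by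
  have hpos : 0 < plusPeriod D₀.f :=
    IsNewform0.plusPeriod_pos_holds D₀.isNewformOf.1 D₀.isNewformOf.coeffField_eq_bot
  have hΩ₀ : E₀.realPeriodRat = |(D₀.c : ℝ)| * plusPeriod D₀.f :=
    D₀.realPeriodRat_eq_abs_mul_plusPeriod_of_latticeEq hopt₀
  have hopt' : ∀ z ∈ D₁.L.lattice, ∃ w ∈ periodLatticeGamma1 D₀.f, z = D₁.c * w := by
    intro z hz
    obtain ⟨w, hw, h⟩ := hopt z hz
    exact ⟨w, by rw [← hf]; exact hw, h⟩
  obtain ⟨j, hj⟩ := realPeriod_eq_of_sublattice D₀.f hpos.ne' s m hm χ hχ D₁.L.lattice D₁.c hopt'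
    W₁.realPeriodRat
    (Summit.BirchSwinnertonDyer.Rank1Residual.ManinAdditive.KatoCurve.neronLatticeRePartAttained_holds W₁ D₁.L
      D₁.isNeronLattice)
  have hΩ₁ : W₁.realPeriodRat ≠ 0 := by
    haveI : (W₁.baseChange ℝ).IsElliptic := by
      rw [WeierstrassCurve.baseChange]; infer_instance
    rw [WeierstrassCurve.realPeriodRat_def]
    exact (W₁.baseChange ℝ).realPeriod_pos'.ne'
  exact padicValRat_ratio_ge s (plusPeriod D₀.f) E₀.realPeriodRat W₁.realPeriodRat j D₁.c
    D₀.maninConstant hj hΩ₀ hc₀ hΩ₁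

end Summit.BirchSwinnertonDyer.BirchSwinnertonDyer.Theorems.PeriodDescentGamma1

namespace Summit.BirchSwinnertonDyer.BirchSwinnertonDyer.Theorems.AnalyticMuTwo

open Summit.BirchSwinnertonDyer.Rank1Residual Literature.NumberTheory.EllipticCurves.Rank1Residual
  Literature.NumberTheory.EllipticCurves.Greenberg1999
  Summit.BirchSwinnertonDyer.BirchSwinnertonDyer.Theorems.PeriodDescentGamma1

/-- **(β) — the registered research stub `stub_periodDescentOfEisenstein` of line `kato-free-lower-sandwich-two`, VERBATIM,
modulo the Literature named fact `exists_optimal_gamma1ParametrizationData`** (the `X₁(N)`-optimal curve of an `X₀(N)`-optimal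
class: Stevens 1989 §2, Conrad–Edixhoven–Stein 2003 §6.1): the witness `W₃` is the `X₁(N)`-optimal curve `W₁`
(`periodDescent_of_gamma1Optimal`; `E₀ ∼ W₁` from the named fact; `f₁ = f₀` by multiplicity one; `c₀` odd by Abbes–Ullmo
at `2 ∤ N`, `N` odd since `E₀` is good ordinary at `2`).  The hypotheses `¬CM`, rank `0`, the `2`-torsion habitat and `χ`'s
shape are not used. [cite: Stevens1989, §2] -/
theorem periodDescentOfEisenstein_of_gamma1Optimal (hex : exists_optimal_gamma1ParametrizationData) :
    Literature.Uncategorized.OrdPublishedInputsAtTwo →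
    abbesUllmo_not_dvd_maninConstant_of_not_dvd_level →
    ∀ (E₀ : WeierstrassCurve ℚ) [E₀.IsElliptic] [E₀.IsGloballyMinimal] [NeZero (E₀.conductorNorm ℤ)]
      (D₀ : ModularParametrizationData E₀ (E₀.conductorNorm ℤ)),
      (∀ z ∈ D₀.L.lattice, ∃ w ∈ periodLattice D₀.f, z = D₀.c * w) →
      ¬ E₀.HasCM → E₀.analyticRank = 0 → GoodOrd E₀ 2 →
      (∃ (W₁ : WeierstrassCurve ℚ) (_ : W₁.IsElliptic) (_ : W₁.IsGloballyMinimal),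
        IsIsogenous E₀ W₁ ∧ ∃ x : ℚ, HasRationalTwoTorsionX W₁ x) →
      ∀ (s : ℕ) (m : Gamma0 (E₀.conductorNorm ℤ) → ℤ),
        (∀ γ, (cuspSymbol D₀.f γ).re = m γ * (plusPeriod D₀.f / 2)) →
      ∀ χ : ZMod (E₀.conductorNorm ℤ) → ZMod (2 ^ (s + 1)),
        (∀ γ, ((m γ : ℤ) : ZMod (2 ^ (s + 1))) = χ (Gamma0Map (E₀.conductorNorm ℤ) γ)) →
      ∃ (W₃ : WeierstrassCurve ℚ) (_ : W₃.IsElliptic) (_ : W₃.IsGloballyMinimal),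
        IsIsogenous E₀ W₃ ∧ ∃ r : ℚ, W₃.realPeriodRat = (r : ℝ) * E₀.realPeriodRat ∧ ((s : ℤ) + 1) ≤ padicValRat 2 r := by
  intro _ hAU E₀ _ _ _ D₀ hopt _ _ hgo _ s m hm χ hχ
  have hord : IsOrdinaryAt E₀ 2 := hgo
  have hN2 : ¬ 2 ∣ E₀.conductorNorm ℤ := not_dvd_level_of_isNewformOf D₀.isNewformOf hord.1
  have hc₀ : ¬ (2 : ℤ) ∣ D₀.maninConstant := by exact_mod_cast hAU E₀ D₀ hopt 2 Nat.prime_two hN2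
  obtain ⟨W₁, i₁, i₂, D₁, hiso, hopt₁⟩ := hex E₀ D₀ hopt
  have hf : D₁.f = D₀.f := Gamma1ParametrizationData.f_eq_of_isIsogenous D₁ D₀ hiso
  exact ⟨W₁, i₁, i₂, IsIsogenous.symm_of_charZero hiso,
    periodDescent_of_gamma1Optimal D₀ hopt hc₀ D₁ hf hopt₁ s m hm χ hχ⟩

end Summit.BirchSwinnertonDyer.BirchSwinnertonDyer.Theorems.AnalyticMuTwo

end
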